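import Summits.ResolutionOfSingularities.ResolutionOfSingularities.Theorems.PurelyInseparableDim4ScopeCover
import Summits.ResolutionOfSingularities.ResolutionOfSingularities.Theorems.PurelyInseparableDim4RidgeBudget
import HarnessLib
import HarnessLib.Audit.Tags

/-!
# Purely inseparable fourfolds — ISOLATION-CERTIFICATE KIT: `decide`-able certificates for
# `IsCert q N F` (`𝔪₀ᴺ ≤ J_q⁺(F) + 𝔪₀ᴺ⁺¹`), `IsIsolated q F`, and colength bounds `jetColength q N F ≤ m`
# on presented states (cell `res-dim4-pi`, F4-I lane; instrument)

[OURS · counted 0 · instrument] Nothing here is a statement about resolution of singularities.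
The cell's isolated-regime census (idea-3's `iso*.py`, crit-4's `inherit5.py`, EN-9's «ISOLATED» label)
certifies isolation of an explicit `F ∈ 𝔽_p[x₁..x₄]` by `𝔽_p` linear algebra: `𝔪₀ᴺ ⊆ J_q⁺(F) + 𝔪₀ᴺ⁺¹`
(p-3's certificate lemma `IsolationCert.isIsolated_of_pow_le_sup_pow_succ`, PR-10), and reads the colength
letter `μ⁺ = dim_K K[x]/(J_q⁺(F) + 𝔪₀ᴺ)` (`RidgeBudget.jetColength`).  So far the tree could only replay
such certificates by hand (`…WildConesGapSpecimen`, `IsolationCert.isIsolated_two_fermatCubic`).  This file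
makes them MECHANICAL on res-dim4-p-13's term lists (`StepKit.Terms 4 K`, `evalT`) with
res-dim4-p-13/idea-2's Hasse derivative on lists (`ScopeCover.hasseL`), settled by `decide` (kernel
evaluation, no `native_decide`) on explicit data over `ZMod p` (or `StepKit.F4`):

* §1 list arithmetic: `mulTL` (term × list), `negL`, `combL L row = Σ c·x^β·D^{(α)}F` for a ROW of steps
  `(α, β, c)`, with the transfer lemmas `evalT_mulTL`, `evalT_negL`, `evalT_combL_mem`
  (`combL L row ∈ J_q⁺(F)` when every `α` has `0 < |α| < q`, checked by `idxOKB`).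
* §2 `memPowB n D` — «the presented polynomial lies in `𝔪₀ⁿ`» read on the list (every listed exponent has
  degree `≥ n` or total coefficient `0`; exact), soundness `mem_pow_of_memPowB`; `rowB q n L γ row` —
  «`x^γ − combL L row ∈ 𝔪₀ⁿ`», soundness `monomial_mem_of_rowB : x^γ ∈ J_q⁺(F) ⊔ 𝔪₀ⁿ`.
* §3 **`certB q N L rows`** (one row per degree-`N` exponent, enumerated by `idxEQ N`) with
  **`isCert_of_certB : … → RidgeBudget.IsCert q N (evalT L)`**, the `J ≤ 𝔪₀` test `vanishB q L`
  (`singLocusIdeal_le_of_vanishB`), and **`isIsolated_of_certB : vanishB … → certB … → IsIsolated q (evalT L)`**.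
* §4 **`spanB q N L B data`** — for every exponent `δ` of degree `< N` a reduction
  `x^δ − Σ_{β ∈ B} c_β x^β − combL L row ∈ 𝔪₀ᴺ` — with **`jetColength_le_of_spanB :
  … → RidgeBudget.jetColength q N (evalT L) ≤ B.length`** (the classes of the monomials `x^β`, `β ∈ B`,
  span `K[x] ⧸ (J_q⁺(F) ⊔ 𝔪₀ᴺ)`).
No instances here (the acceptance test is the sequel `…HeightBudgetFalse`: crit-4's H1 chain, six isolation
certificates and one colength bound, all by `decide`).  OURS; counted 0.
bears_on: LADDER-RESOLUTION:D157-DOOR2 (res-dim4-pi · F4-I instrument). Supports stmt-ResolutionOfSingularities-16155 (helper).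
-/

set_option linter.dupNamespace false -- mandated namespace of this single-conjunct summit

noncomputable section

open MvPolynomial Finset

namespace Summit.ResolutionOfSingularities.ResolutionOfSingularities.Theorems.PIDim4

namespace IsoCertKit

open StepKit ScopeCover
open Literature.AlgebraicGeometry.Resolution

variable {K : Type} [Field K]

/-! ## §1 List arithmetic: term × list, negation, `J`-combinations -/

/-- `expo` is additive. [folklore] -/
theorem expo_add (e e' : Fin 4 → ℕ) : expo (e + e') = expo e + expo e' :=
  Finsupp.ext fun _ => rfl

/-- Product of one term `c·x^e` with a term list. [folklore] -/
def mulTL (t : (Fin 4 → ℕ) × K) (L : Terms 4 K) : Terms 4 K :=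
  L.map fun s => (t.1 + s.1, t.2 * s.2)

/-- **Transfer**: `evalT (mulTL t L) = (c·x^e) · evalT L`. [folklore] -/
theorem evalT_mulTL (t : (Fin 4 → ℕ) × K) (L : Terms 4 K) :
    evalT (mulTL t L) = monomial (expo t.1) t.2 * evalT L := by
  induction L with
  | nil => simp [mulTL]
  | cons s L ih =>
    simp only [mulTL, List.map_cons, evalT_cons] at ih ⊢
    rw [mul_add, ← ih, monomial_mul, expo_add]

/-- Negation of a term list. [folklore] -/
def negL (L : Terms 4 K) : Terms 4 K := L.map fun t => (t.1, -t.2)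

/-- **Transfer**: `evalT (negL L) = − evalT L`. [folklore] -/
theorem evalT_negL (L : Terms 4 K) : evalT (negL L) = -evalT L := by
  induction L with
  | nil => simp [negL]
  | cons t L ih =>
    simp only [negL, List.map_cons, evalT_cons] at ih ⊢
    rw [ih, map_neg, neg_add]

/-- A certificate ROW: steps `(α, β, c)` standing for `c · x^β · D^{(α)}F`. [folklore] -/
abbrev Row (K : Type) : Type := List ((Fin 4 → ℕ) × (Fin 4 → ℕ) × K)

/-- The `J`-combination `Σ_{(α,β,c) ∈ row} c·x^β·D^{(α)}F` of a row, on lists. [folklore] -/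
def combL (L : Terms 4 K) : Row K → Terms 4 K
  | [] => []
  | s :: row => mulTL (s.2.1, s.2.2) (hasseL s.1 L) ++ combL L row

/-- Every step index `α` of the row has `0 < |α| < q`. [folklore] -/
def idxOKB (q : ℕ) (row : Row K) : Bool :=
  row.all fun s => decide (0 < ∑ i, s.1 i ∧ ∑ i, s.1 i < q)

/-- **`combL L row ∈ J_q⁺(evalT L)`** when the step indices are admissible. [folklore] -/
theorem evalT_combL_mem {q : ℕ} (L : Terms 4 K) {row : Row K} (h : idxOKB q row = true) :
    evalT (combL L row) ∈ singLocusIdeal q (evalT L) := by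
  induction row with
  | nil => simp [combL]
  | cons s row ih =>
    simp only [idxOKB, List.all_cons, Bool.and_eq_true, decide_eq_true_eq] at h
    rw [combL, evalT_append]
    refine Ideal.add_mem _ ?_ (ih (by simpa [idxOKB] using h.2))
    rw [evalT_mulTL, ← hasseDeriv_evalT]
    refine Ideal.mul_mem_left _ _ (Ideal.subset_span ⟨expo s.1, ?_, ?_, rfl⟩)
    · rw [degree_expo]; exact h.1.1
    · rw [degree_expo]; exact h.1.2

/-! ## §2 Membership in `𝔪₀ⁿ` read on a list; one certificate row -/

/-- «`evalT D ∈ 𝔪₀ⁿ`» on the list: every listed exponent has degree `≥ n` or total coefficient `0`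
(exact: the support of `evalT D` is contained in the listed exponents). [folklore] -/
def memPowB [DecidableEq K] (n : ℕ) (D : Terms 4 K) : Bool :=
  D.all fun t => decide (n ≤ ∑ i, t.1 i) || decide (coeffAt D t.1 = 0)

/-- **Soundness of `memPowB`.** [folklore] -/
theorem mem_pow_of_memPowB [DecidableEq K] {n : ℕ} {D : Terms 4 K} (h : memPowB n D = true) :
    evalT D ∈ originIdeal K ^ n := by
  rw [IsolationCert.mem_originIdeal_pow_iff]
  intro d hd
  rw [coeff_evalT]
  by_contra hne
  obtain ⟨t, ht, hte⟩ := exists_mem_of_coeffAt_ne_zero hne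
  have h' := List.all_eq_true.mp h t ht
  simp only [Bool.or_eq_true, decide_eq_true_eq] at h'
  have hdeg : d.degree = ∑ i, t.1 i := by rw [← expo_coe d, degree_expo, ← hte]
  rcases h' with h1 | h2
  · omega
  · exact hne (hte ▸ h2)

/-- ROW CHECK: admissible indices and `x^γ − combL L row ∈ 𝔪₀ⁿ`. [folklore] -/
def rowB [DecidableEq K] (q n : ℕ) (L : Terms 4 K) (γ : Fin 4 → ℕ) (row : Row K) : Bool :=
  idxOKB q row && memPowB n ((γ, (1 : K)) :: negL (combL L row))

/-- **Soundness of a row**: `x^γ ∈ J_q⁺(F) ⊔ 𝔪₀ⁿ`. [folklore] -/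
theorem monomial_mem_of_rowB [DecidableEq K] {q n : ℕ} {L : Terms 4 K} {γ : Fin 4 → ℕ} {row : Row K}
    (h : rowB q n L γ row = true) :
    monomial (expo γ) (1 : K) ∈ singLocusIdeal q (evalT L) ⊔ originIdeal K ^ n := by
  simp only [rowB, Bool.and_eq_true] at h
  have hG := evalT_combL_mem L h.1 (q := q)
  have hR := mem_pow_of_memPowB h.2
  rw [evalT_cons, evalT_negL] at hR
  have : monomial (expo γ) (1 : K) =
      evalT (combL L row) + (monomial (expo γ) 1 + -evalT (combL L row)) := by ring
  rw [this]
  exact Submodule.add_mem_sup hG hR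

/-! ## §3 The isolation certificate -/

/-- All exponents `γ : Fin 4 → ℕ` of degree exactly `N`. [folklore] -/
def idxEQ (N : ℕ) : List (Fin 4 → ℕ) :=
  (List.range (N + 1)).flatMap fun a => (List.range (N + 1)).flatMap fun b =>
    (List.range (N + 1)).flatMap fun c => (List.range (N + 1)).filterMap fun d =>
      if a + b + c + d = N then some ![a, b, c, d] else none

/-- `idxEQ N` enumerates every exponent of degree `N`. [folklore] -/
theorem mem_idxEQ {N : ℕ} {γ : Fin 4 →₀ ℕ} (h : γ.degree = N) : (⇑γ) ∈ idxEQ N := by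
  have hsum : γ.degree = γ 0 + γ 1 + γ 2 + γ 3 := by
    rw [← CentreBlowup.degIn_univ]; simp [CentreBlowup.degIn, Fin.sum_univ_four]
  have hfun : (⇑γ) = ![γ 0, γ 1, γ 2, γ 3] := by funext i; fin_cases i <;> rfl
  rw [hfun]
  simp only [idxEQ, List.mem_flatMap, List.mem_range, List.mem_filterMap]
  refine ⟨γ 0, by omega, γ 1, by omega, γ 2, by omega, γ 3, by omega, ?_⟩
  rw [if_pos (by omega)]

/-- The row filed for the exponent `γ` (empty if none). [folklore] -/
def rowOf (rows : List ((Fin 4 → ℕ) × Row K)) (γ : Fin 4 → ℕ) : Row K :=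
  match rows.find? fun r => decide (r.1 = γ) with
  | some r => r.2
  | none => []

/-- **ISOLATION CERTIFICATE CHECK at level `N`**: every degree-`N` monomial passes its row at `𝔪₀ᴺ⁺¹`.
[folklore] -/
def certB [DecidableEq K] (q N : ℕ) (L : Terms 4 K) (rows : List ((Fin 4 → ℕ) × Row K)) : Bool :=
  (idxEQ N).all fun γ => rowB q (N + 1) L γ (rowOf rows γ)

/-- **Soundness: `certB` ⇒ the certificate `𝔪₀ᴺ ≤ J_q⁺(F) ⊔ 𝔪₀ᴺ⁺¹`** (`RidgeBudget.IsCert`). [folklore] -/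
theorem isCert_of_certB [DecidableEq K] {q N : ℕ} {L : Terms 4 K} {rows : List ((Fin 4 → ℕ) × Row K)}
    (h : certB q N L rows = true) : RidgeBudget.IsCert q N (evalT L) := by
  refine IsolationCert.pow_le_sup_pow_succ_of_forall_monomial fun γ hγ => ?_
  have hrow := List.all_eq_true.mp h (⇑γ) (mem_idxEQ hγ)
  rw [← expo_coe γ]
  exact monomial_mem_of_rowB hrow

/-- `J_q⁺(F) ≤ 𝔪₀` on the list: every Hasse derivative of order in `(0, q)` has constant term `0`. [folklore] -/
def vanishB [DecidableEq K] (q : ℕ) (L : Terms 4 K) : Bool :=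
  (idxLT q).all fun α => decide (coeffAt (hasseL α L) 0 = 0)

/-- **Soundness of `vanishB`.** [folklore] -/
theorem singLocusIdeal_le_of_vanishB [DecidableEq K] {q : ℕ} {L : Terms 4 K} (h : vanishB q L = true) :
    singLocusIdeal q (evalT L) ≤ originIdeal K := by
  refine IsolationCert.singLocusIdeal_le_originIdeal_of_forall fun α h0 hq => ?_
  have hα := List.all_eq_true.mp h (⇑α) (mem_idxLT h0 hq)
  rw [decide_eq_true_eq] at hα
  rw [← expo_coe α, hasseDeriv_evalT, constantCoeff_eq, coeff_evalT, Finsupp.coe_zero]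
  exact hα

/-- **ISOLATED by certificate**: `vanishB` and `certB` at some level give `IsIsolated q F`
(p-3's `IsolationCert.isIsolated_of_pow_le_sup_pow_succ`). [folklore] -/
theorem isIsolated_of_certB [DecidableEq K] {q N : ℕ} {L : Terms 4 K}
    {rows : List ((Fin 4 → ℕ) × Row K)} (hv : vanishB q L = true) (h : certB q N L rows = true) :
    IsIsolated q (evalT L) :=
  IsolationCert.isIsolated_of_pow_le_sup_pow_succ (singLocusIdeal_le_of_vanishB hv) (isCert_of_certB h)

/-! ## §4 Colength bounds: a spanning set of monomials for `K[x] ⧸ (J_q⁺(F) ⊔ 𝔪₀ᴺ)` -/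

/-- The term list `Σ_{(β, c)} c·x^β` of a coefficient vector on exponents. [folklore] -/
def linL (v : List ((Fin 4 → ℕ) × K)) : Terms 4 K := v

/-- All exponents of degree `< N`: `0` and `ScopeCover.idxLT N`. [folklore] -/
def idxBelow (N : ℕ) : List (Fin 4 → ℕ) := (fun _ => 0) :: idxLT N

/-- `idxBelow N` enumerates every exponent of degree `< N`. [folklore] -/
theorem mem_idxBelow {N : ℕ} {δ : Fin 4 →₀ ℕ} (h : δ.degree < N) : (⇑δ) ∈ idxBelow N := by
  by_cases h0 : δ.degree = 0
  · have : δ = 0 := (Finsupp.degree_eq_zero_iff δ).mp h0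
    subst this
    exact List.mem_cons_self
  · exact List.mem_cons_of_mem _ (mem_idxLT (Nat.pos_of_ne_zero h0) h)

/-- REDUCTION ROW CHECK for `δ`: `x^δ − Σ c_β x^β − combL L row ∈ 𝔪₀ᴺ`, with every `β` taken from `B`.
[folklore] -/
def spanRowB [DecidableEq K] (q N : ℕ) (L : Terms 4 K) (B : List (Fin 4 → ℕ)) (δ : Fin 4 → ℕ)
    (v : List ((Fin 4 → ℕ) × K)) (row : Row K) : Bool :=
  (v.all fun t => decide (t.1 ∈ B)) && idxOKB q row &&
    memPowB N ((δ, (1 : K)) :: (negL (linL v) ++ negL (combL L row)))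

/-- The reduction data filed for `δ` (empty if none). [folklore] -/
def dataOf (data : List ((Fin 4 → ℕ) × List ((Fin 4 → ℕ) × K) × Row K)) (δ : Fin 4 → ℕ) :
    List ((Fin 4 → ℕ) × K) × Row K :=
  match data.find? fun r => decide (r.1 = δ) with
  | some r => r.2
  | none => ([], [])

/-- **COLENGTH-BOUND CHECK**: every exponent of degree `< N` reduces to the span of the monomials `x^β`,
`β ∈ B`, modulo `J_q⁺(F) ⊔ 𝔪₀ᴺ`. [folklore] -/
def spanB [DecidableEq K] (q N : ℕ) (L : Terms 4 K) (B : List (Fin 4 → ℕ))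
    (data : List ((Fin 4 → ℕ) × List ((Fin 4 → ℕ) × K) × Row K)) : Bool :=
  (idxBelow N).all fun δ => spanRowB q N L B δ (dataOf data δ).1 (dataOf data δ).2

/-- The class of `x^β` in `K[x] ⧸ I`. [folklore] -/
def cls (I : Ideal (MvPolynomial (Fin 4) K)) (β : Fin 4 → ℕ) : MvPolynomial (Fin 4) K ⧸ I :=
  Ideal.Quotient.mkₐ K I (monomial (expo β) 1)

/-- `evalT` of a coefficient vector supported on `B` maps into the span of the classes `x^β`, `β ∈ B`.
[folklore] -/
theorem mk_evalT_mem_span {I : Ideal (MvPolynomial (Fin 4) K)} {B : List (Fin 4 → ℕ)}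
    {v : List ((Fin 4 → ℕ) × K)} (hv : ∀ t ∈ v, t.1 ∈ B) :
    Ideal.Quotient.mkₐ K I (evalT v) ∈ Submodule.span K {x | x ∈ B.map (cls I)} := by
  induction v with
  | nil => simp
  | cons t v ih =>
    rw [evalT_cons, map_add]
    refine Submodule.add_mem _ ?_ (ih fun s hs => hv s (List.mem_cons_of_mem _ hs))
    have : monomial (expo t.1) t.2 = t.2 • monomial (expo t.1) (1 : K) := by
      rw [smul_monomial, smul_eq_mul, mul_one]
    rw [this, map_smul]
    refine Submodule.smul_mem _ _ (Submodule.subset_span ?_)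
    exact List.mem_map.mpr ⟨t.1, hv t List.mem_cons_self, rfl⟩

/-- **Soundness of a reduction row**: the class of `x^δ` lies in the span of the classes `x^β`, `β ∈ B`,
in `K[x] ⧸ (J_q⁺(F) ⊔ 𝔪₀ᴺ)`. [folklore] -/
theorem cls_mem_span_of_spanRowB [DecidableEq K] {q N : ℕ} {L : Terms 4 K} {B : List (Fin 4 → ℕ)}
    {δ : Fin 4 → ℕ} {v : List ((Fin 4 → ℕ) × K)} {row : Row K}
    (h : spanRowB q N L B δ v row = true) :
    cls (singLocusIdeal q (evalT L) ⊔ originIdeal K ^ N) δ ∈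
      Submodule.span K {x | x ∈ B.map (cls (singLocusIdeal q (evalT L) ⊔ originIdeal K ^ N))} := by
  simp only [spanRowB, Bool.and_eq_true, List.all_eq_true, decide_eq_true_eq] at h
  obtain ⟨⟨hvB, hidx⟩, hmem⟩ := h
  set I := singLocusIdeal q (evalT L) ⊔ originIdeal K ^ N with hI
  have hG : evalT (combL L row) ∈ I := Ideal.mem_sup_left (evalT_combL_mem L hidx)
  have hR : evalT ((δ, (1 : K)) :: (negL (linL v) ++ negL (combL L row))) ∈ I :=
    Ideal.mem_sup_right (mem_pow_of_memPowB hmem)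
  rw [evalT_cons, evalT_append, evalT_negL, evalT_negL, linL] at hR
  -- `x^δ ≡ evalT v (mod I)`
  have hdiff : monomial (expo δ) (1 : K) - evalT v ∈ I := by
    have : monomial (expo δ) (1 : K) - evalT v =
        (monomial (expo δ) 1 + (-evalT v + -evalT (combL L row))) + evalT (combL L row) := by ring
    rw [this]
    exact I.add_mem hR hG
  have heq : cls I δ = Ideal.Quotient.mkₐ K I (evalT v) := by
    rw [cls, Ideal.Quotient.mkₐ_eq_mk, Ideal.Quotient.eq]
    exact hdiff
  rw [heq]
  exact mk_evalT_mem_span hvB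

/-- **Soundness: `spanB` ⇒ `jetColength q N F ≤ |B|`.**  The classes of ALL monomials lie in the span of the
classes `x^β`, `β ∈ B` (degree `≥ N`: zero; degree `< N`: the filed reduction row), so that span is the
whole quotient, whose dimension is then at most `|B|`. [folklore] -/
theorem jetColength_le_of_spanB [DecidableEq K] {q N : ℕ} {L : Terms 4 K} {B : List (Fin 4 → ℕ)}
    {data : List ((Fin 4 → ℕ) × List ((Fin 4 → ℕ) × K) × Row K)} (h : spanB q N L B data = true) :
    RidgeBudget.jetColength q N (evalT L) ≤ B.length := by
  classical
  set I := singLocusIdeal q (evalT L) ⊔ originIdeal K ^ N with hI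
  set S : Set (MvPolynomial (Fin 4) K ⧸ I) := {x | x ∈ B.map (cls I)} with hS
  -- every monomial class lies in the span
  have hmono : ∀ d : Fin 4 →₀ ℕ,
      Ideal.Quotient.mkₐ K I (monomial d (1 : K)) ∈ Submodule.span K S := by
    intro d
    by_cases hd : d.degree < N
    · have hrow := List.all_eq_true.mp h (⇑d) (mem_idxBelow hd)
      have := cls_mem_span_of_spanRowB hrow
      rwa [cls, expo_coe] at this
    · have hmem : monomial d (1 : K) ∈ I := by
        refine Ideal.mem_sup_right ?_
        rw [IsolationCert.originIdeal_eq_idealOfVars]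
        exact Literature.RingTheory.MvPolynomial.monomial_mem_idealOfVars_pow_of_le (by omega) _
      rw [Ideal.Quotient.mkₐ_eq_mk, Ideal.Quotient.eq_zero_iff_mem.mpr hmem]
      exact Submodule.zero_mem _
  -- hence the span is everything
  have htop : Submodule.span K S = ⊤ := by
    rw [eq_top_iff]
    rintro x -
    obtain ⟨g, rfl⟩ := Ideal.Quotient.mkₐ_surjective K I x
    rw [g.as_sum, map_sum]
    refine Submodule.sum_mem _ fun d _ => ?_
    have : monomial d (coeff d g) = coeff d g • monomial d (1 : K) := by
      rw [smul_monomial, smul_eq_mul, mul_one]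
    rw [this, map_smul]
    exact Submodule.smul_mem _ _ (hmono d)
  -- and its dimension is at most `|B|`
  have hle : Module.finrank K (Submodule.span K S) ≤ B.length := by
    rw [hS, ← List.coe_toFinset]
    refine (finrank_span_finset_le_card _).trans ((List.toFinset_card_le _).trans ?_)
    rw [List.length_map]
  rw [RidgeBudget.jetColength, ← hI, ← finrank_top, ← htop]
  exact hle

end IsoCertKit

end Summit.ResolutionOfSingularities.ResolutionOfSingularities.Theorems.PIDim4

end
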